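import Mathlib.RingTheory.Regular.RegularSequence
import HarnessLib

/-!
# d-sequences for modules and the Goto–Yamagishi equality (Kawasaki 2000, §2; Česnavičius 2021, §3.7–3.8)

Topic: `Literature/AlgebraicGeometry/Resolution`. Bottom brick of the proof of the named facts
`KawasakiMacaulayfication` / `CesnaviciusMacaulayfication` (`Macaulayfication.lean`,
`MacaulayficationOverCMLocus.lean`): Kawasaki's Cohen–Macaulay blowing ups `Bl_{∏ᵢ (r₁,…,rᵢ)}`
(Kawasaki 2000, Thm 4.1 = Česnavičius 2021, Thm 3.13) rest on **`d`-sequences** (Huneke 1982),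
the weak form of regular sequences satisfied by CM-secant (`p`-standard) sequences, and on the
**Goto–Yamagishi equality** for them (Kawasaki 2000, Thm 2.2; Česnavičius 2021, (3.8.1)), the base
case of Kawasaki's interwoven induction (Kawasaki 2000, Thm 3.1) and the input of Claim 3.13.2 of
Česnavičius's proof.

Source followed: K. Česnavičius, *Macaulayfication of Noetherian schemes*, Duke Math. J. 170
(2021) = arXiv:1810.04493v2, Def. 3.7 and Rem. 3.8 (p. 9 of the arXiv version), whose printed
proof of (3.8.1) ("by increasing induction on `n` and decreasing induction on `i` the second
[equality] follows from its trivial cases `i = s + 1` and `n = 1`") is formalized verbatim: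

* `IsDSequence M rs` — Def. 3.7: `rs = [r₁,…,r_s]` is a `d`-sequence for the `R`-module `M` if
  for every `1 ≤ i ≤ s` multiplication by `rᵢ` is injective on
  `(r₁,…,r_s)M/(r₁,…,rᵢ₋₁)M ⊆ M/(r₁,…,rᵢ₋₁)M` (indices are `0`-based in Lean: the condition at
  `i < rs.length` is about `rs[i]` and the submodule `(rs.take i)M`);
* `IsDSequence.nil`, `IsDSequence.take` (initial segments), and
  `RingTheory.Sequence.IsWeaklyRegular.isDSequence` (every weakly regular sequence is a
  `d`-sequence — the sense in which the notion weakens regularity, Rem. after Def. 3.7);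
* `IsDSequence.take_smul_top_inf_pow_smul_top` — **Goto–Yamagishi / Kawasaki 2000 Thm 2.2**,
  second equality of (3.8.1): with `𝔮 = (r₁,…,r_s)`, for all `n ≥ 1` and all `i`,
  `(r₁,…,rᵢ₋₁)M ∩ 𝔮ⁿM = (r₁,…,rᵢ₋₁)𝔮ⁿ⁻¹M` (stated with `n + 1` in place of `n`);
* `IsDSequence.colon_inf_pow_smul_top` — first equality of (3.8.1):
  `((r₁,…,rᵢ₋₁)M :_M rᵢ) ∩ 𝔮ⁿM = (r₁,…,rᵢ₋₁)𝔮ⁿ⁻¹M`;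
* `IsDSequence.take_smul_top_inf_pow_smul_top'` — the same with the product ideal
  `(r₁,…,rᵢ₋₁)·𝔮ⁿ⁻¹` as printed.

Everything is proved; no named fact is introduced. The statements are over an arbitrary
commutative ring and module (no Noetherian or finiteness hypothesis is used, as in the source).

## References

* [Cesnavicius2021] K. Česnavičius, Duke Math. J. 170 (2021) 1419–1455, Def. 3.7, Rem. 3.8,
  (3.8.1) "The equality (3.8.1) is due to Goto and Yamagishi and is also proved in [Kaw00] 2.2".
* [Kawasaki2000] T. Kawasaki, Trans. AMS 352 (2000) 2517–2552, §2, Thm 2.2.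
* [Huneke1982] C. Huneke, *The theory of d-sequences and powers of ideals*, Adv. Math. 46 (1982)
  249–279 (the notion, for ideals, with an extra minimality condition not imposed here).
* [HerrmannIkedaOrbanz1988] HIO, *Equimultiplicity and blowing up*, (38.6) b).

## What is NOT here

CM-secant / `p`-standard sequences and the fact that they are `d`-sequences (Kawasaki 2000,
2.9–2.10, via Schenzel's annihilator theorem and local duality); Kawasaki 2000, Thm 3.1–3.3;
the blowing-up computation (Thm 4.1).
-/

namespace Literature.AlgebraicGeometry.Resolution

open Ideal Submodule
open scoped Pointwise

universe u v

variable {R : Type u} [CommRing R] (M : Type v) [AddCommGroup M] [Module R M]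

/-- **`d`-sequence for a module** (Huneke 1982; in the module form of Česnavičius 2021, Def. 3.7 =
Kawasaki 2000, §2): the list `rs = [r₁, …, r_s]` of ring elements is a `d`-sequence for the
`R`-module `M` if for every `i` multiplication by `rᵢ` is injective on the submodule
`(r₁,…,r_s)M/(r₁,…,rᵢ₋₁)M` of `M/(r₁,…,rᵢ₋₁)M`; i.e. for `m ∈ (r₁,…,r_s)M`,
`rᵢ m ∈ (r₁,…,rᵢ₋₁)M` implies `m ∈ (r₁,…,rᵢ₋₁)M`. In Lean the indices are `0`-based: the
condition at `i < rs.length` concerns `rs[i]` and the submodule `(rs.take i)M =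
Ideal.ofList (rs.take i) • ⊤`. (Huneke's original definition, for `M = R`, also asks that no `rᵢ`
lie in the ideal generated by the others; following Kawasaki and Česnavičius this minimality is
not imposed.) [cite: Cesnavicius2021, Def. 3.7] -/
@[mk_iff]
structure IsDSequence (rs : List R) : Prop where
  /-- `rs[i]` is a non-zero-divisor on `(rs)M/(rs.take i)M` -/
  mem_of_smul_mem : ∀ (i : ℕ) (hi : i < rs.length), ∀ m ∈ (ofList rs • ⊤ : Submodule R M),
    rs[i] • m ∈ (ofList (rs.take i) • ⊤ : Submodule R M) →
      m ∈ (ofList (rs.take i) • ⊤ : Submodule R M)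

/-! ## Bookkeeping on the ideals `(r₁,…,rᵢ)` and the submodules `𝔮ⁿM` -/

/-- `(r₁,…,rᵢ) ⊆ (r₁,…,r_s)`. [folklore] -/
theorem ofList_take_le (rs : List R) (i : ℕ) : ofList (rs.take i) ≤ ofList rs :=
  Ideal.span_mono fun _ hr => List.mem_of_mem_take hr

/-- `(r₁,…,rᵢ) ⊆ (r₁,…,rⱼ)` for `i ≤ j`. [folklore] -/
theorem ofList_take_mono (rs : List R) {i j : ℕ} (hij : i ≤ j) :
    ofList (rs.take i) ≤ ofList (rs.take j) := by
  have : rs.take i = (rs.take j).take i := by rw [List.take_take, Nat.min_eq_left hij]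
  rw [this]
  exact ofList_take_le _ _

/-- `(r₁,…,rᵢ₊₁) = (r₁,…,rᵢ) + (rᵢ₊₁)`. [folklore] -/
theorem ofList_take_succ (rs : List R) {i : ℕ} (hi : i < rs.length) :
    ofList (rs.take (i + 1)) = ofList (rs.take i) ⊔ span {rs[i]} := by
  rw [List.take_succ_eq_append_getElem hi, ofList_append, ofList_singleton]

/-- `rᵢ ∈ (r₁,…,r_s)`. [folklore] -/
theorem getElem_mem_ofList (rs : List R) {i : ℕ} (hi : i < rs.length) : rs[i] ∈ ofList rs :=
  Ideal.subset_span (List.getElem_mem hi)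

variable {M}

/-- `𝔮ⁿ⁺¹M = 𝔮(𝔮ⁿM)`. [folklore] -/
theorem pow_succ_smul_top (q : Ideal R) (n : ℕ) :
    (q ^ (n + 1) • ⊤ : Submodule R M) = q • (q ^ n • ⊤ : Submodule R M) := by
  rw [pow_succ', Submodule.mul_smul]

/-- `𝔮ⁿ⁺¹M ⊆ 𝔮M`. [folklore] -/
theorem pow_succ_smul_top_le (q : Ideal R) (n : ℕ) :
    (q ^ (n + 1) • ⊤ : Submodule R M) ≤ q • ⊤ := by
  rw [pow_succ_smul_top]
  exact smul_mono le_rfl le_top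

/-- If `x ∈ I·P` and `r ∈ J` then `r x ∈ I·(J·P)` (commutativity of the ring). [folklore] -/
theorem smul_mem_smul_smul_of_mem_smul {I J : Ideal R} {P : Submodule R M} {r : R} {x : M}
    (hr : r ∈ J) (hx : x ∈ I • P) : r • x ∈ I • (J • P) := by
  refine Submodule.smul_induction_on hx (fun a ha p hp => ?_) (fun x y hx hy => ?_)
  · rw [smul_comm r a p]
    exact smul_mem_smul ha (smul_mem_smul hr hp)
  · rw [smul_add]
    exact add_mem hx hy

/-- The easy inclusion `(r₁,…,rᵢ₋₁)𝔮ⁿM ⊆ (r₁,…,rᵢ₋₁)M ∩ 𝔮ⁿ⁺¹M` (no hypothesis on `rs`).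
[folklore] -/
theorem take_smul_pow_smul_top_le (rs : List R) (n i : ℕ) :
    (ofList (rs.take i) • (ofList rs ^ n • ⊤ : Submodule R M) : Submodule R M) ≤
      (ofList (rs.take i) • ⊤ : Submodule R M) ⊓ (ofList rs ^ (n + 1) • ⊤) :=
  le_inf (smul_mono le_rfl le_top)
    (by rw [pow_succ_smul_top]; exact smul_mono_left (ofList_take_le rs i))

/-- The trivial case `i ≥ s` ("`i = s + 1`" in the source's `1`-based numbering) of the
Goto–Yamagishi equality: `(r₁,…,r_s)M ∩ 𝔮ⁿ⁺¹M = 𝔮ⁿ⁺¹M = (r₁,…,r_s)𝔮ⁿM` (no hypothesis on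
`rs`). [cite: Cesnavicius2021, Rem. 3.8] -/
theorem take_smul_top_inf_pow_smul_top_of_length_le (rs : List R) (n : ℕ) {i : ℕ}
    (hi : rs.length ≤ i) :
    (ofList (rs.take i) • ⊤ : Submodule R M) ⊓ (ofList rs ^ (n + 1) • ⊤) =
      ofList (rs.take i) • (ofList rs ^ n • ⊤ : Submodule R M) := by
  rw [List.take_of_length_le hi, pow_succ_smul_top]
  exact inf_eq_right.mpr (smul_mono le_rfl le_top)

/-- The trivial case `n = 1` of the Goto–Yamagishi equality:
`(r₁,…,rᵢ₋₁)M ∩ 𝔮M = (r₁,…,rᵢ₋₁)M` (no hypothesis on `rs`). [cite: Cesnavicius2021, Rem. 3.8] -/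
theorem take_smul_top_inf_smul_top (rs : List R) (i : ℕ) :
    (ofList (rs.take i) • ⊤ : Submodule R M) ⊓ (ofList rs ^ (0 + 1) • ⊤) =
      ofList (rs.take i) • (ofList rs ^ 0 • ⊤ : Submodule R M) := by
  refine le_antisymm (inf_le_left.trans_eq ?_) (take_smul_pow_smul_top_le rs 0 i)
  rw [pow_zero, one_eq_top, Submodule.top_smul]

namespace IsDSequence

/-- The empty sequence is a `d`-sequence. [folklore] -/
theorem nil : IsDSequence M ([] : List R) :=
  ⟨fun i hi => absurd hi (Nat.not_lt_zero i)⟩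

/-- **Initial segments of a `d`-sequence are `d`-sequences.** [cite: Cesnavicius2021, Def. 3.7] -/
theorem take {rs : List R} (h : IsDSequence M rs) (j : ℕ) : IsDSequence M (rs.take j) := by
  refine ⟨fun i hi m hm hrm => ?_⟩
  have hij : i ≤ j := by
    have := List.length_take_le j rs
    omega
  have hi' : i < rs.length := lt_of_lt_of_le hi (List.length_take_le' j rs)
  have htake : (rs.take j).take i = rs.take i := by rw [List.take_take, Nat.min_eq_left hij]
  rw [htake] at hrm ⊢
  rw [List.getElem_take] at hrm
  exact h.mem_of_smul_mem i hi' m (smul_mono_left (ofList_take_le rs j) hm) hrm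

/-- **Every weakly regular sequence is a `d`-sequence** (the `d`-sequence condition asks for the
injectivity of `rᵢ` only on the submodule `(r₁,…,r_s)M/(r₁,…,rᵢ₋₁)M` of `M/(r₁,…,rᵢ₋₁)M`,
weak regularity on all of it; Česnavičius 2021, before Def. 3.7: "the following weak version … of
the definition of a regular sequence"). [cite: Cesnavicius2021, Def. 3.7] -/
theorem _root_.RingTheory.Sequence.IsWeaklyRegular.isDSequence {rs : List R}
    (h : RingTheory.Sequence.IsWeaklyRegular M rs) : IsDSequence M rs := by
  refine ⟨fun i hi m _ hrm => ?_⟩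
  have hreg := h.regular_mod_prev i hi
  have key : rs[i] • (Submodule.Quotient.mk m : M ⧸ (ofList (rs.take i) • ⊤ : Submodule R M)) =
      rs[i] • (0 : M ⧸ (ofList (rs.take i) • ⊤ : Submodule R M)) := by
    rw [smul_zero, ← Submodule.Quotient.mk_smul, Submodule.Quotient.mk_eq_zero]
    exact hrm
  exact (Submodule.Quotient.mk_eq_zero _).mp (hreg key)

/-- **Goto–Yamagishi equality** (Kawasaki 2000, Thm 2.2; Česnavičius 2021, (3.8.1), second
equality): if `rs = [r₁,…,r_s]` is a `d`-sequence for `M` and `𝔮 = (r₁,…,r_s)`, then for every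
`n ≥ 0` and every `i` (here `0`-based, `rs.take i` = "`r₁,…,rᵢ`"; for `i ≥ s` both sides are
`𝔮ⁿ⁺¹M`):
`(r₁,…,rᵢ)M ∩ 𝔮ⁿ⁺¹M = (r₁,…,rᵢ)·𝔮ⁿM`.
Printed proof, followed verbatim: increasing induction on `n` and decreasing induction on `i` from
the trivial cases `i = s` and `n = 0`; in the inductive step, with `z ∈ (r₁,…,rᵢ)M ∩ 𝔮ⁿ⁺²M ⊆
(r₁,…,rᵢ₊₁)M ∩ 𝔮ⁿ⁺²M = (r₁,…,rᵢ₊₁)𝔮ⁿ⁺¹M` write `z = w + rᵢ₊₁y` with `w ∈ (r₁,…,rᵢ)𝔮ⁿ⁺¹M`,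
`y ∈ 𝔮ⁿ⁺¹M`; then `rᵢ₊₁y ∈ (r₁,…,rᵢ)M`, so `y ∈ (r₁,…,rᵢ)M` by the `d`-sequence condition, hence
`y ∈ (r₁,…,rᵢ)M ∩ 𝔮ⁿ⁺¹M = (r₁,…,rᵢ)𝔮ⁿM` and `rᵢ₊₁y ∈ (r₁,…,rᵢ)𝔮ⁿ⁺¹M`.
[cite: Kawasaki2000, Thm 2.2] -/
theorem take_smul_top_inf_pow_smul_top {rs : List R} (h : IsDSequence M rs) (n i : ℕ) :
    (ofList (rs.take i) • ⊤ : Submodule R M) ⊓ (ofList rs ^ (n + 1) • ⊤) =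
      ofList (rs.take i) • (ofList rs ^ n • ⊤ : Submodule R M) := by
  induction n generalizing i with
  | zero => exact take_smul_top_inf_smul_top rs i
  | succ m ih =>
    -- the inductive step at `i < s`, given the statement for `i + 1` (decreasing induction on `i`)
    have key : ∀ i, ∀ hi : i < rs.length,
        (ofList (rs.take (i + 1)) • ⊤ : Submodule R M) ⊓ (ofList rs ^ (m + 1 + 1) • ⊤) =
          ofList (rs.take (i + 1)) • (ofList rs ^ (m + 1) • ⊤ : Submodule R M) →
        (ofList (rs.take i) • ⊤ : Submodule R M) ⊓ (ofList rs ^ (m + 1 + 1) • ⊤) =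
          ofList (rs.take i) • (ofList rs ^ (m + 1) • ⊤ : Submodule R M) := by
      intro i hi ih1
      refine le_antisymm ?_ (take_smul_pow_smul_top_le rs (m + 1) i)
      intro z hz
      obtain ⟨hzN, hzQ⟩ := Submodule.mem_inf.mp hz
      -- `z ∈ (r₁,…,rᵢ₊₁)M ∩ 𝔮ᵐ⁺²M = (r₁,…,rᵢ₊₁)𝔮ᵐ⁺¹M = (r₁,…,rᵢ)𝔮ᵐ⁺¹M + rᵢ₊₁𝔮ᵐ⁺¹M`
      have hz' : z ∈ ofList (rs.take (i + 1)) • (ofList rs ^ (m + 1) • ⊤ : Submodule R M) := by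
        rw [← ih1]
        exact Submodule.mem_inf.mpr
          ⟨smul_mono_left (ofList_take_mono rs (Nat.le_succ i)) hzN, hzQ⟩
      rw [ofList_take_succ rs hi, Submodule.sup_smul, Submodule.ideal_span_singleton_smul] at hz'
      obtain ⟨w, hw, y', hy', rfl⟩ := Submodule.mem_sup.mp hz'
      obtain ⟨y, hy, rfl⟩ := (Submodule.mem_smul_pointwise_iff_exists y' rs[i] _).mp hy'
      -- `rᵢ₊₁ y = z - w ∈ (r₁,…,rᵢ)M`
      have hwN : w ∈ (ofList (rs.take i) • ⊤ : Submodule R M) := smul_mono le_rfl le_top hw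
      have hry : rs[i] • y ∈ (ofList (rs.take i) • ⊤ : Submodule R M) := by
        have := sub_mem hzN hwN
        rwa [add_sub_cancel_left] at this
      -- the `d`-sequence condition: `y ∈ (r₁,…,rᵢ)M`, hence `y ∈ (r₁,…,rᵢ)𝔮ᵐM` by induction
      have hyN : y ∈ (ofList (rs.take i) • ⊤ : Submodule R M) :=
        h.mem_of_smul_mem i hi y (pow_succ_smul_top_le (ofList rs) m hy) hry
      have hy₂ : y ∈ ofList (rs.take i) • (ofList rs ^ m • ⊤ : Submodule R M) := by
        rw [← ih i]
        exact Submodule.mem_inf.mpr ⟨hyN, hy⟩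
      have hry₂ : rs[i] • y ∈ ofList (rs.take i) • (ofList rs ^ (m + 1) • ⊤ : Submodule R M) := by
        rw [pow_succ_smul_top]
        exact smul_mem_smul_smul_of_mem_smul (getElem_mem_ofList rs hi) hy₂
      exact add_mem hw hry₂
    -- decreasing induction on `i`, from the trivial case `i ≥ s`
    have desc : ∀ j i, rs.length ≤ i + j →
        (ofList (rs.take i) • ⊤ : Submodule R M) ⊓ (ofList rs ^ (m + 1 + 1) • ⊤) =
          ofList (rs.take i) • (ofList rs ^ (m + 1) • ⊤ : Submodule R M) := by
      intro j
      induction j with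
      | zero =>
        intro i hij
        exact take_smul_top_inf_pow_smul_top_of_length_le rs (m + 1) (by omega)
      | succ j ihj =>
        intro i hij
        by_cases hi : rs.length ≤ i
        · exact take_smul_top_inf_pow_smul_top_of_length_le rs (m + 1) hi
        · exact key i (by omega) (ihj (i + 1) (by omega))
    exact desc rs.length i (by omega)

/-- **Goto–Yamagishi equality, product-ideal form** (as printed in Kawasaki 2000, Thm 2.2 /
Česnavičius 2021, (3.8.1)): `(r₁,…,rᵢ)M ∩ 𝔮ⁿ⁺¹M = ((r₁,…,rᵢ)·𝔮ⁿ)M` for a `d`-sequence.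
[cite: Kawasaki2000, Thm 2.2] -/
theorem take_smul_top_inf_pow_smul_top' {rs : List R} (h : IsDSequence M rs) (n i : ℕ) :
    (ofList (rs.take i) • ⊤ : Submodule R M) ⊓ (ofList rs ^ (n + 1) • ⊤) =
      (ofList (rs.take i) * ofList rs ^ n) • (⊤ : Submodule R M) := by
  rw [Submodule.mul_smul]
  exact h.take_smul_top_inf_pow_smul_top n i

/-- **First equality of (3.8.1)** (Česnavičius 2021, Rem. 3.8: "no element of `𝔮M` maps to a
nonzero `rᵢ`-torsion element of `M/(r₁,…,rᵢ₋₁)M`"): for a `d`-sequence and `i < s`,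
`((r₁,…,rᵢ)M :_M rᵢ₊₁) ∩ 𝔮ⁿ⁺¹M = (r₁,…,rᵢ)M ∩ 𝔮ⁿ⁺¹M` (`0`-based `i`; the colon submodule
`{m | rᵢ₊₁ m ∈ (r₁,…,rᵢ)M}` is the preimage of `(r₁,…,rᵢ)M` under multiplication by `rs[i]`).
[cite: Cesnavicius2021, Rem. 3.8, (3.8.1)] -/
theorem colon_inf_pow_smul_top_eq_inf {rs : List R} (h : IsDSequence M rs) (n : ℕ) {i : ℕ}
    (hi : i < rs.length) :
    ((ofList (rs.take i) • ⊤ : Submodule R M).comap (LinearMap.lsmul R M rs[i])) ⊓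
        (ofList rs ^ (n + 1) • ⊤) =
      (ofList (rs.take i) • ⊤ : Submodule R M) ⊓ (ofList rs ^ (n + 1) • ⊤) := by
  refine le_antisymm (fun m hm => ?_) (inf_le_inf_right _ fun m hm => ?_)
  · obtain ⟨hm, hmq⟩ := Submodule.mem_inf.mp hm
    rw [Submodule.mem_comap, LinearMap.lsmul_apply] at hm
    exact Submodule.mem_inf.mpr
      ⟨h.mem_of_smul_mem i hi m (pow_succ_smul_top_le (ofList rs) n hmq) hm, hmq⟩
  · rw [Submodule.mem_comap, LinearMap.lsmul_apply]
    exact Submodule.smul_mem _ _ hm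

/-- **Goto–Yamagishi equality, colon form** (Kawasaki 2000, Thm 2.2; Česnavičius 2021, (3.8.1),
both equalities combined): for a `d`-sequence and `i < s`,
`((r₁,…,rᵢ)M :_M rᵢ₊₁) ∩ 𝔮ⁿ⁺¹M = (r₁,…,rᵢ)·𝔮ⁿM`. [cite: Kawasaki2000, Thm 2.2] -/
theorem colon_inf_pow_smul_top {rs : List R} (h : IsDSequence M rs) (n : ℕ) {i : ℕ}
    (hi : i < rs.length) :
    ((ofList (rs.take i) • ⊤ : Submodule R M).comap (LinearMap.lsmul R M rs[i])) ⊓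
        (ofList rs ^ (n + 1) • ⊤) =
      ofList (rs.take i) • (ofList rs ^ n • ⊤ : Submodule R M) := by
  rw [h.colon_inf_pow_smul_top_eq_inf n hi, h.take_smul_top_inf_pow_smul_top n i]

end IsDSequence

end Literature.AlgebraicGeometry.Resolution
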